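import Mathlib
import HarnessLib
import Literature.Analysis.FluidPDE.ClassicalSolution
import Literature.Analysis.FluidPDE.ClassicalSolutionCalculus
import Literature.Analysis.FluidPDE.EnergyToolkit
import Literature.Analysis.FluidPDE.VorticityEquation
import Literature.Analysis.FluidPDE.AxisymmetricVorticityTransport
import Literature.Analysis.FluidPDE.PressurePoisson
import Literature.Analysis.FluidPDE.TaoEnstrophyLocalisation
import Summits.NavierStokesRegularity.NavierStokesRegularity.Theorems.UnthreadedRigidityDoorUnthreadedRigidityProfileHornDefs

/-!
# Route `UnthreadedRigidityDoor`, item `UnthreadedRigidity` (W2, stmt-NavierStokesRegularity-27585) — THREADING JETS: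
# the one-sided time-jets of the threading flux of a classical solution ARE the formal jets
# (the «M-part» — formal jet = one-sided jet — of the bridges PH `HornIdentityTwo` / LEMMA SEP `SeparableOrderOneSilence`
# of LINE g10-2 «PROFILE HORN» and V `OrderTwoVirialIdentity` of LINE g11-1 «VIRIAL HORN»; CARD VirialHorn §6–§7, residual R4)

Seat ns-crc-p1 g8 (lineage re-based on W2 by director-ns req205/req207), `--supports stmt-NavierStokesRegularity-27585 --as helper`.

THE POINT.  The slice-level bridges of the two RUNG lines are stated for a classical solution `u, p` of the unforced
Navier–Stokes system (`ν = 1`) on `[t₀, T)` (`IsClassicalNSSolutionOn (Ico t₀ T) 1 0 u p`) and hypothesise / conclude on the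
ONE-SIDED time-jets at `t₀` of the THREADING FLUX `F(t, x) = ⟪curl u(t)(x), x − x₀⟫` (`ProfileHorn.threadingFlux`), namely
`derivWithin F(·, x) (Ici t₀) t₀` and `iteratedDerivWithin 2 F(·, x) (Ici t₀) t₀`.  Their «M-part» is the statement that these jets
are the FORMAL jets obtained by differentiating the equation: with `u₀ = u(t₀)`, `p₀ = p(t₀)`,

* `∂ₜ⁺F(t₀, x)  = ⟪curl (Δu₀ − (u₀·∇)u₀)(x), x − x₀⟫`                      (`derivWithin_threadingFlux_Ici`),
* `∂ₜ⁺∂ₜ⁺F(t₀, x) = ⟪curl (Δu₁ − (u₀·∇)u₁ − (u₁·∇)u₀)(x), x − x₀⟫`,  `u₁ := Δu₀ − (u₀·∇)u₀ − ∇p₀`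
  (`iteratedDerivWithin_two_threadingFlux_Ici`),
so that each bridge becomes a statement about EXPLICIT fields `(u₀, p₀)` on `ℝ³` (the «L-part»: the slice algebra (F1)/(F2) and the
virial lemma (F3) of the cards), with NO Navier–Stokes solution left in it.  This file proves the two displayed identities; the pressure
Poisson equation at `t₀`, the open-window (two-sided) versions and the reductions of the named bridges to slice statements are
filed separately (`…ThreadingJetsSlice`).

PROOF (all inputs are tree theorems).  §1 calculus UP TO THE BOUNDARY of a time set `S ⊆ closure (interior S)` of unique
differentiability (`[t₀, T)` qualifies): from the exchange of the one-sided `∂ₜ = timeDerivWithin S` with spatial derivatives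
(`EnergyToolkit`, `IsSmoothSpaceTimeOn.timeDerivWithin_fderiv_slice_apply`) the product rule for `(a·∇)c`, `∂ₜΔ = Δ∂ₜ` (both
private in `ClassicalNSBackwardUniqueness`, re-proved on `ℝ³`), `curl ∂ₜ∇p = 0`; and `curl ∂ₜ = ∂ₜ curl`
(`VorticityEquation`).  §2 for a classical solution on such `S`: `∂ₜF = ⟪curl ∂ₜu, x − x₀⟫`, the momentum equation solved for `∂ₜu`
and differentiated once in time, `∂ₜ∂ₜF = ⟪curl ∂ₜ∂ₜu, x − x₀⟫` with the curl-free `∂ₜ∇p` dropped.  §3 `[t₀, ∞)` and `[t₀, T)`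
coincide near every `t < T`, so the jets within `Ici t₀` are those within `Ico t₀ T` of §2.

HONEST FRAMING: calculus/bookkeeping for HYPOTHETICAL classical solutions — the regularity dictionary of two RUNG lines on the wall
item; nothing here bears on `UnthreadedRigidity` (27585), the door Target, W2 or Navier–Stokes regularity; no summit statement is
proved; the bridges themselves (their L-parts) are NOT touched.  MODEL/rung work. [folklore]

References: A. J. Majda, A. L. Bertozzi, *Vorticity and Incompressible Flow* (CUP 2002) §1.1, Prop. 2.4 (vector identities, the
vorticity equation); T. Tao, *Localisation and compactness …* (2011/2013), (8) (pressure Poisson equation).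
-/

noncomputable section

-- the summit and its single sub-problem share the name (CONVENTIONS §1), as in every Theorems file
set_option linter.dupNamespace false

namespace Summit.NavierStokesRegularity.NavierStokesRegularity.Theorems.UnthreadedRigidity

open Set Function Filter Topology
open scoped RealInnerProductSpace InnerProductSpace ContDiff Laplacian
open Literature.Analysis.FluidPDE
open Summit.NavierStokesRegularity.NavierStokesRegularity.Theorems.UnthreadedRigidity.ProfileHorn (E3 threadingFlux)

namespace ThreadingJets

variable {S : Set ℝ}

/-! ### 1. Space–time calculus up to the boundary of the time set -/

/-- `curl` of a pointwise difference of fields differentiable at `x`. [folklore] -/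
theorem curl_fun_sub {f g : E3 → E3} {x : E3} (hf : DifferentiableAt ℝ f x)
    (hg : DifferentiableAt ℝ g x) : curl (fun z => f z - g z) x = curl f x - curl g x := by
  rw [curl_eq_curlCLM, curl_eq_curlCLM, curl_eq_curlCLM, fderiv_fun_sub hf hg, map_sub]

/-- Time derivative (within `S`) of the pairing of a jointly smooth field with a FIXED vector:
`∂ₜ ⟪w(·)(x), c⟫ (t) = ⟪∂ₜw(t)(x), c⟫`. [folklore] -/
theorem derivWithin_inner_const {w : ℝ → E3 → E3} (h : IsSmoothSpaceTimeOn S w)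
    (hS : UniqueDiffOn ℝ S) {t : ℝ} (ht : t ∈ S) (x c : E3) :
    derivWithin (fun s => ⟪w s x, c⟫) S t = ⟪timeDerivWithin S w t x, c⟫ := by
  have h1 := (h.hasDerivWithinAt_timeDerivWithin hS ht x).inner ℝ (hasDerivWithinAt_const t S c)
  simp only [inner_zero_right, zero_add] at h1
  exact h1.derivWithin (hS t ht)

/-- **Product rule for the convective term up to the boundary of the time set**:
`∂ₜ((a·∇)c) = (a·∇)∂ₜc + (∂ₜa·∇)c` on `S × ℝ³` for jointly smooth `a`, `c` (`S` of unique differentiability with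
`S ⊆ closure (interior S)`; `∂ₜ = timeDerivWithin S`).  (The tree has this as a private lemma of
`ClassicalNSBackwardUniqueness`; re-proved here for `ℝ³`.) [folklore] -/
theorem timeDerivWithin_convect {a c : ℝ → E3 → E3} (ha : IsSmoothSpaceTimeOn S a)
    (hc : IsSmoothSpaceTimeOn S c) (hS : UniqueDiffOn ℝ S) (hcl : S ⊆ closure (interior S)) {t : ℝ}
    (ht : t ∈ S) (x : E3) :
    timeDerivWithin S (fun s y => convect (a s) (c s) y) t x =
      convect (a t) (timeDerivWithin S c t) x + convect (timeDerivWithin S a t) (c t) x := by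
  -- operator form of the exchange `∂ₜ D(c ·)(x) = D(∂ₜ c)(x)`
  have hop : timeDerivWithin S (fun s y => fderiv ℝ (c s) y) t x = fderiv ℝ (timeDerivWithin S c t) x := by
    refine ContinuousLinearMap.ext fun e => ?_
    have h1 := (hc.fderiv_slice hS).timeDerivWithin_clm_comp hS
      (ContinuousLinearMap.apply ℝ E3 e) ht x
    simp only [ContinuousLinearMap.apply_apply] at h1
    rw [← h1]
    exact hc.timeDerivWithin_fderiv_slice_apply hS hcl ht x e
  have hF : HasDerivWithinAt (fun s => fderiv ℝ (c s) x)
      (timeDerivWithin S (fun s y => fderiv ℝ (c s) y) t x) S t :=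
    (hc.fderiv_slice hS).hasDerivWithinAt_timeDerivWithin hS ht x
  rw [hop] at hF
  have hg : HasDerivWithinAt (fun s => a s x) (timeDerivWithin S a t x) S t :=
    ha.hasDerivWithinAt_timeDerivWithin hS ht x
  have h := hF.clm_apply hg
  rw [timeDerivWithin_apply]
  simp only [convect]
  exact h.derivWithin (hS t ht)

/-- **`∂ₜ Δ = Δ ∂ₜ` up to the boundary of the time set** for a jointly smooth field on `S × ℝ³`
(`Δ = Σᵢ ∂ᵢ∂ᵢ` and the exchange of `∂ₜ` with each `∂ᵢ` twice).  (Private in `ClassicalNSBackwardUniqueness`;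
re-proved here for `ℝ³`.) [folklore] -/
theorem timeDerivWithin_laplacian {c : ℝ → E3 → E3} (hc : IsSmoothSpaceTimeOn S c)
    (hS : UniqueDiffOn ℝ S) (hcl : S ⊆ closure (interior S)) {t : ℝ} (ht : t ∈ S) (x : E3) :
    timeDerivWithin S (fun s y => (Δ (c s)) y) t x = (Δ (timeDerivWithin S c t)) x := by
  set b := stdOrthonormalBasis ℝ E3
  have h1 : ∀ i, IsSmoothSpaceTimeOn S (fun s y => fderiv ℝ (c s) y (b i)) := fun i =>
    hc.fderiv_slice_apply hS (b i)
  have h2 : ∀ i, IsSmoothSpaceTimeOn S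
      (fun s y => fderiv ℝ (fun z => fderiv ℝ (c s) z (b i)) y (b i)) := fun i =>
    (h1 i).fderiv_slice_apply hS (b i)
  have hG : ∀ i, timeDerivWithin S (fun s y => fderiv ℝ (fun z => fderiv ℝ (c s) z (b i)) y (b i))
      t x = fderiv ℝ (fun z => fderiv ℝ (timeDerivWithin S c t) z (b i)) x (b i) := by
    intro i
    rw [(h1 i).timeDerivWithin_fderiv_slice_apply hS hcl ht x (b i)]
    have heq : timeDerivWithin S (fun s y => fderiv ℝ (c s) y (b i)) t =
        fun z => fderiv ℝ (timeDerivWithin S c t) z (b i) :=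
      funext fun z => hc.timeDerivWithin_fderiv_slice_apply hS hcl ht z (b i)
    rw [heq]
  have hsum : HasDerivWithinAt (fun s => ∑ i, fderiv ℝ (fun z => fderiv ℝ (c s) z (b i)) x (b i))
      (∑ i, fderiv ℝ (fun z => fderiv ℝ (timeDerivWithin S c t) z (b i)) x (b i)) S t := by
    have h := HasDerivWithinAt.fun_sum (u := Finset.univ)
      fun i _ => (h2 i).hasDerivWithinAt_timeDerivWithin hS ht x
    refine (h.congr_deriv ?_)
    exact Finset.sum_congr rfl fun i _ => hG i
  have h2c : ∀ s ∈ S, ContDiff ℝ 2 (c s) := fun s hs => (hc.contDiff_slice hs).of_le (by norm_cast)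
  have h2d : ContDiff ℝ 2 (timeDerivWithin S c t) :=
    ((hc.timeDerivWithin hS).contDiff_slice ht).of_le (by norm_cast)
  rw [timeDerivWithin_apply]
  have hcongr : derivWithin (fun s => (Δ (c s)) x) S t =
      derivWithin (fun s => ∑ i, fderiv ℝ (fun z => fderiv ℝ (c s) z (b i)) x (b i)) S t :=
    derivWithin_congr (fun s hs => laplacian_eq_sum_fderiv_fderiv b (h2c s hs) x)
      (laplacian_eq_sum_fderiv_fderiv b (h2c t ht) x)
  rw [hcongr, hsum.derivWithin (hS t ht), laplacian_eq_sum_fderiv_fderiv b h2d x]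

/-- **`curl ∂ₜ ∇p = 0` up to the boundary of the time set**: the time derivative (within `S`) of the slice
gradient of a jointly smooth scalar field is curl free (`curl ∂ₜ∇p = ∂ₜ curl ∇p = ∂ₜ 0`). [folklore] -/
theorem curl_timeDerivWithin_gradient_eq_zero {p : ℝ → E3 → ℝ} (hp : IsSmoothSpaceTimeOn S p)
    (hS : UniqueDiffOn ℝ S) (hcl : S ⊆ closure (interior S)) {t : ℝ} (ht : t ∈ S) (x : E3) :
    curl (timeDerivWithin S (fun s y => gradient (p s) y) t) x = 0 := by
  have hG : IsSmoothSpaceTimeOn S (fun s y => gradient (p s) y) := hp.gradient hS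
  rw [hG.curl_timeDerivWithin hS hcl ht x, timeDerivWithin_apply]
  have h0 : ∀ s ∈ S, vorticity (fun s y => gradient (p s) y) s x = 0 := fun s hs => by
    rw [vorticity_apply]
    exact curl_gradient_eq_zero_holds (p s) ((hp.contDiff_slice hs).of_le (by norm_cast)) x
  rw [derivWithin_congr h0 (h0 t ht)]
  simp only [derivWithin_fun_const, Pi.zero_apply]

/-! ### 2. The jets of the threading flux of a classical solution (time set `S ⊆ closure (interior S)`) -/

section Classical

variable {u : ℝ → E3 → E3} {p : ℝ → E3 → ℝ}

/-- **The momentum equation solved for the time derivative**: for a classical solution of the unforced system with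
unit viscosity, `∂ₜu(t) = Δu(t) − (u(t)·∇)u(t) − ∇p(t)` as fields on `ℝ³`, `t ∈ S` (`∂ₜ = timeDerivWithin S`). [folklore] -/
theorem timeDerivWithin_velocity_eq (h : IsClassicalNSSolutionOn S 1 0 u p) {t : ℝ} (ht : t ∈ S) :
    timeDerivWithin S u t = fun z => (Δ (u t)) z - convect (u t) (u t) z - gradient (p t) z := by
  funext z
  have hm := h.momentum t ht z
  simp only [one_smul, Pi.zero_apply, add_zero] at hm
  rw [eq_sub_of_add_eq hm]
  abel

/-- **FIRST JET, operator form**: `∂ₜ ⟪curl u(·)(x), x − x₀⟫ (t) = ⟪curl ∂ₜu(t)(x), x − x₀⟫` within `S` at every `t ∈ S`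
(exchange of `∂ₜ` and `curl` up to the boundary, `IsSmoothSpaceTimeOn.curl_timeDerivWithin`). [folklore] -/
theorem derivWithin_threadingFlux (h : IsClassicalNSSolutionOn S 1 0 u p) (hS : UniqueDiffOn ℝ S)
    (hcl : S ⊆ closure (interior S)) {t : ℝ} (ht : t ∈ S) (x₀ x : E3) :
    derivWithin (fun s => threadingFlux u x₀ s x) S t = ⟪curl (timeDerivWithin S u t) x, x - x₀⟫ := by
  have hω := h.smooth_velocity.isSmoothSpaceTimeOn_vorticity hS
  have e1 : derivWithin (fun s => threadingFlux u x₀ s x) S t =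
      derivWithin (fun s => ⟪vorticity u s x, x - x₀⟫) S t := rfl
  rw [e1, derivWithin_inner_const hω hS ht x (x - x₀), ← h.smooth_velocity.curl_timeDerivWithin hS hcl ht x]

/-- **FIRST JET = FORMAL FIRST JET**: `∂ₜF(t, x) = ⟪curl (Δu − (u·∇)u − ∇p)(t)(x), x − x₀⟫` within `S` at `t ∈ S`. [folklore] -/
theorem derivWithin_threadingFlux_eq (h : IsClassicalNSSolutionOn S 1 0 u p) (hS : UniqueDiffOn ℝ S)
    (hcl : S ⊆ closure (interior S)) {t : ℝ} (ht : t ∈ S) (x₀ x : E3) :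
    derivWithin (fun s => threadingFlux u x₀ s x) S t =
      ⟪curl (fun z => (Δ (u t)) z - convect (u t) (u t) z - gradient (p t) z) x, x - x₀⟫ := by
  rw [derivWithin_threadingFlux h hS hcl ht, timeDerivWithin_velocity_eq h ht]

/-- Differentiability of the convective term of smooth fields. [folklore] -/
theorem differentiable_convect {a c : E3 → E3} (ha : ContDiff ℝ ∞ a) (hc : ContDiff ℝ ∞ c) :
    Differentiable ℝ (convect a c) := by
  have h1 : Differentiable ℝ (fderiv ℝ c) :=
    (hc.fderiv_right (m := 1) (by norm_cast)).differentiable (by simp)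
  have : convect a c = fun y => fderiv ℝ c y (a y) := rfl
  rw [this]
  exact h1.clm_apply (ha.differentiable (by simp))

/-- Differentiability of the gradient of a smooth scalar field. [folklore] -/
theorem differentiable_gradient {q : E3 → ℝ} (hq : ContDiff ℝ ∞ q) : Differentiable ℝ (gradient q) :=
  ((InnerProductSpace.toDual ℝ E3).symm.contDiff.comp (hq.fderiv_right (m := 1) (by norm_cast))).differentiable
    (by simp)

/-- **FIRST JET, pressure-free form**: `∂ₜF(t, x) = ⟪curl (Δu − (u·∇)u)(t)(x), x − x₀⟫` within `S` at `t ∈ S`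
(`curl ∇p = 0`). [folklore] -/
theorem derivWithin_threadingFlux_eq' (h : IsClassicalNSSolutionOn S 1 0 u p) (hS : UniqueDiffOn ℝ S)
    (hcl : S ⊆ closure (interior S)) {t : ℝ} (ht : t ∈ S) (x₀ x : E3) :
    derivWithin (fun s => threadingFlux u x₀ s x) S t =
      ⟪curl (fun z => (Δ (u t)) z - convect (u t) (u t) z) x, x - x₀⟫ := by
  rw [derivWithin_threadingFlux_eq h hS hcl ht]
  have hu : ContDiff ℝ ∞ (u t) := h.contDiff_velocity ht
  have hp : ContDiff ℝ ∞ (p t) := h.contDiff_pressure ht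
  have hΔd : Differentiable ℝ (Δ (u t)) := differentiable_laplacian (hu.of_le (by norm_cast))
  have hcd : Differentiable ℝ (convect (u t) (u t)) := differentiable_convect hu hu
  have hgd : Differentiable ℝ (gradient (p t)) := differentiable_gradient hp
  rw [curl_fun_sub ((hΔd x).fun_sub (hcd x)) (hgd x)]
  have h0 : curl (fun z => gradient (p t) z) x = 0 :=
    curl_gradient_eq_zero_holds (p t) (hp.of_le (by norm_cast)) x
  rw [h0, sub_zero]

/-- **The momentum equation differentiated once in time**: with `U := ∂ₜu` (within `S`),
`∂ₜU(t) = ΔU(t) − ((u·∇)U + (U·∇)u)(t) − ∂ₜ∇p(t)` as fields on `ℝ³`, `t ∈ S` (exchange of `∂ₜ` with `Δ`, product rule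
for the convective term, up to the boundary of `S`). [folklore] -/
theorem timeDerivWithin_timeDerivWithin_velocity (h : IsClassicalNSSolutionOn S 1 0 u p)
    (hS : UniqueDiffOn ℝ S) (hcl : S ⊆ closure (interior S)) {t : ℝ} (ht : t ∈ S) :
    timeDerivWithin S (timeDerivWithin S u) t = fun z =>
      (Δ (timeDerivWithin S u t)) z
        - (convect (u t) (timeDerivWithin S u t) z + convect (timeDerivWithin S u t) (u t) z)
        - timeDerivWithin S (fun s y => gradient (p s) y) t z := by
  have hu := h.smooth_velocity
  have hp := h.smooth_pressure
  have hA : IsSmoothSpaceTimeOn S (fun s y => (Δ (u s)) y) := hu.laplacian hS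
  have hB : IsSmoothSpaceTimeOn S (fun s y => convect (u s) (u s) y) := hu.convect hu hS
  have hC : IsSmoothSpaceTimeOn S (fun s y => gradient (p s) y) := hp.gradient hS
  funext z
  have hcongr : timeDerivWithin S (timeDerivWithin S u) t z =
      timeDerivWithin S (fun s y => (Δ (u s)) y - convect (u s) (u s) y - gradient (p s) y) t z :=
    timeDerivWithin_congr_on (fun s hs y => by rw [timeDerivWithin_velocity_eq h hs]) ht z
  rw [hcongr, (hA.sub hB).timeDerivWithin_fun_sub hC hS ht z, hA.timeDerivWithin_fun_sub hB hS ht z,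
    timeDerivWithin_laplacian hu hS hcl ht z, timeDerivWithin_convect hu hu hS hcl ht z]

/-- **SECOND JET, operator form**: with `U := ∂ₜu` (within `S`),
`∂ₜ∂ₜF(t, x) = ⟪curl (ΔU − (u·∇)U − (U·∇)u)(t)(x), x − x₀⟫` within `S` at `t ∈ S` — the pressure enters only through
`U(t) = Δu − (u·∇)u − ∇p`; the term `∂ₜ∇p` is curl free. [folklore] -/
theorem derivWithin_derivWithin_threadingFlux (h : IsClassicalNSSolutionOn S 1 0 u p)
    (hS : UniqueDiffOn ℝ S) (hcl : S ⊆ closure (interior S)) {t : ℝ} (ht : t ∈ S) (x₀ x : E3) :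
    derivWithin (fun s => derivWithin (fun r => threadingFlux u x₀ r x) S s) S t =
      ⟪curl (fun z => (Δ (timeDerivWithin S u t)) z
        - (convect (u t) (timeDerivWithin S u t) z + convect (timeDerivWithin S u t) (u t) z)) x, x - x₀⟫ := by
  have hu := h.smooth_velocity
  have hU := hu.timeDerivWithin hS
  have hωU := hU.isSmoothSpaceTimeOn_vorticity hS
  have e1 : ∀ s ∈ S, derivWithin (fun r => threadingFlux u x₀ r x) S s =
      ⟪vorticity (timeDerivWithin S u) s x, x - x₀⟫ :=
    fun s hs => derivWithin_threadingFlux h hS hcl hs x₀ x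
  rw [derivWithin_congr e1 (e1 t ht), derivWithin_inner_const hωU hS ht x (x - x₀),
    ← hU.curl_timeDerivWithin hS hcl ht x, timeDerivWithin_timeDerivWithin_velocity h hS hcl ht]
  have hUs : ContDiff ℝ ∞ (timeDerivWithin S u t) := hU.contDiff_slice ht
  have hus : ContDiff ℝ ∞ (u t) := h.contDiff_velocity ht
  have hGs : ContDiff ℝ ∞ (timeDerivWithin S (fun s y => gradient (p s) y) t) :=
    ((h.smooth_pressure.gradient hS).timeDerivWithin hS).contDiff_slice ht
  have d1 : Differentiable ℝ (Δ (timeDerivWithin S u t)) :=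
    differentiable_laplacian (hUs.of_le (by norm_cast))
  have d2 : Differentiable ℝ (convect (u t) (timeDerivWithin S u t)) := differentiable_convect hus hUs
  have d3 : Differentiable ℝ (convect (timeDerivWithin S u t) (u t)) := differentiable_convect hUs hus
  have d4 : Differentiable ℝ (timeDerivWithin S (fun s y => gradient (p s) y) t) :=
    hGs.differentiable (by simp)
  rw [curl_fun_sub ((d1 x).fun_sub ((d2 x).fun_add (d3 x))) (d4 x),
    curl_timeDerivWithin_gradient_eq_zero h.smooth_pressure hS hcl ht x, sub_zero]

end Classical

/-! ### 3. The left end of `[t₀, T)`: the ONE-SIDED jets within `Ici t₀` (the shape of the bridges PH / LEMMA SEP / V) -/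

section Endpoint

variable {u : ℝ → E3 → E3} {p : ℝ → E3 → ℝ} {t₀ T : ℝ}

/-- `[t₀, T)` lies in the closure of its interior (`t₀ < T`). [folklore] -/
theorem Ico_subset_closure_interior (h : t₀ < T) : Ico t₀ T ⊆ closure (interior (Ico t₀ T)) := by
  rw [interior_Ico, closure_Ioo h.ne]
  exact Ico_subset_Icc_self

/-- Near a time `t < T` the sets `[t₀, ∞)` and `[t₀, T)` coincide. [folklore] -/
theorem Ici_eventuallyEq_Ico {t : ℝ} (ht : t < T) : (Ici t₀ : Set ℝ) =ᶠ[𝓝 t] (Ico t₀ T : Set ℝ) := by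
  filter_upwards [Iio_mem_nhds ht] with r hr
  show (r ∈ Ici t₀) = (r ∈ Ico t₀ T)
  simp only [mem_Ici, mem_Ico, eq_iff_iff]
  exact ⟨fun h => ⟨h, hr⟩, fun h => h.1⟩

/-- One-sided derivatives within `[t₀, ∞)` and within `[t₀, T)` agree at times `t < T`. [folklore] -/
theorem derivWithin_Ici_eq_Ico {f : ℝ → ℝ} {t : ℝ} (ht : t < T) :
    derivWithin f (Ici t₀) t = derivWithin f (Ico t₀ T) t :=
  derivWithin_congr_set (Ici_eventuallyEq_Ico ht)

/-- The second iterated derivative within a set is the twice-repeated derivative within it. [folklore] -/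
theorem iteratedDerivWithin_two (f : ℝ → ℝ) (s : Set ℝ) :
    iteratedDerivWithin 2 f s = derivWithin (fun r => derivWithin f s r) s := by
  rw [show (2 : ℕ) = 1 + 1 from rfl, iteratedDerivWithin_succ, iteratedDerivWithin_one]

/-- The second iterated derivative within `[t₀, ∞)` at `t₀` is the twice-repeated derivative within `[t₀, T)`. [folklore] -/
theorem iteratedDerivWithin_two_Ici_eq (f : ℝ → ℝ) (hT : t₀ < T) :
    iteratedDerivWithin 2 f (Ici t₀) t₀ =
      derivWithin (fun s => derivWithin f (Ico t₀ T) s) (Ico t₀ T) t₀ := by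
  rw [iteratedDerivWithin_two]
  have h1 : derivWithin f (Ici t₀) =ᶠ[𝓝[Ici t₀] t₀] fun s => derivWithin f (Ico t₀ T) s := by
    filter_upwards [mem_nhdsWithin_of_mem_nhds (Iio_mem_nhds hT)] with s hs
    exact derivWithin_Ici_eq_Ico hs
  rw [h1.derivWithin_eq (derivWithin_Ici_eq_Ico hT), derivWithin_congr_set (Ici_eventuallyEq_Ico hT)]

/-- **ONE-SIDED FIRST JET at the initial time** (the M-part of LEMMA SEP, `ProfileHorn.SeparableOrderOneSilence`): for a
classical solution on `[t₀, T)`, `∂ₜ⁺F(t₀, x) = ⟪curl (Δu₀ − (u₀·∇)u₀)(x), x − x₀⟫`, `u₀ = u(t₀)` — a differential expression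
in the initial datum alone. [folklore] -/
theorem derivWithin_threadingFlux_Ici (h : IsClassicalNSSolutionOn (Ico t₀ T) 1 0 u p) (hT : t₀ < T)
    (x₀ x : E3) :
    derivWithin (fun t => threadingFlux u x₀ t x) (Ici t₀) t₀ =
      ⟪curl (fun z => (Δ (u t₀)) z - convect (u t₀) (u t₀) z) x, x - x₀⟫ := by
  have ht₀ : t₀ ∈ Ico t₀ T := ⟨le_rfl, hT⟩
  rw [derivWithin_Ici_eq_Ico hT,
    derivWithin_threadingFlux_eq' h (uniqueDiffOn_Ico t₀ T) (Ico_subset_closure_interior hT) ht₀]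

/-- **ONE-SIDED SECOND JET at the initial time = FORMAL SECOND JET** (the M-part of the bridges PH `HornIdentityTwo` and
V `OrderTwoVirialIdentity`): for a classical solution on `[t₀, T)` with `u₀ = u(t₀)`, `p₀ = p(t₀)` and
`u₁ := Δu₀ − (u₀·∇)u₀ − ∇p₀`,
`∂ₜ⁺∂ₜ⁺F(t₀, x) = ⟪curl (Δu₁ − (u₀·∇)u₁ − (u₁·∇)u₀)(x), x − x₀⟫` — a differential expression in `(u₀, p₀)` alone
(`p₀` is tied to `u₀` by `Δp₀ = −div((u₀·∇)u₀)` and — in the bridges — by its decay). [folklore] -/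
theorem iteratedDerivWithin_two_threadingFlux_Ici (h : IsClassicalNSSolutionOn (Ico t₀ T) 1 0 u p)
    (hT : t₀ < T) (x₀ x : E3) :
    iteratedDerivWithin 2 (fun t => threadingFlux u x₀ t x) (Ici t₀) t₀ =
      ⟪curl (fun z =>
          (Δ (fun y => (Δ (u t₀)) y - convect (u t₀) (u t₀) y - gradient (p t₀) y)) z
          - (convect (u t₀) (fun y => (Δ (u t₀)) y - convect (u t₀) (u t₀) y - gradient (p t₀) y) z
              + convect (fun y => (Δ (u t₀)) y - convect (u t₀) (u t₀) y - gradient (p t₀) y) (u t₀) z)) x,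
        x - x₀⟫ := by
  have ht₀ : t₀ ∈ Ico t₀ T := ⟨le_rfl, hT⟩
  rw [iteratedDerivWithin_two_Ici_eq _ hT,
    derivWithin_derivWithin_threadingFlux h (uniqueDiffOn_Ico t₀ T) (Ico_subset_closure_interior hT) ht₀,
    timeDerivWithin_velocity_eq h ht₀]

end Endpoint

end ThreadingJets

end Summit.NavierStokesRegularity.NavierStokesRegularity.Theorems.UnthreadedRigidity

end
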